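import Literature.Analysis.FluidPDE.PlanarInterpShearProfile
import HarnessLib

/-!
# The saturated compensated coordinate: a globally smooth transverse coordinate

Topic `Literature/Analysis/FluidPDE`. The compensated transverse coordinate `compCoord D x s` of
`PlanarInterpShearProfile.lean` is smooth and solves its first-order equation on the band
`|s| < D/2` only. The elements of the pullback calculus need GLOBALLY smooth fields (they are cut
off by the chain's partition functions only afterwards), so the offset `s` is first passed through
a smooth **saturation** `satOffset S ρ` (`= s` on `[-S + 2ρ/3, S + ρ/3]`, values in
`[-S + ρ/2, S + ρ/2]`): `compCoordSat D S ρ x s = compCoord D x (satOffset S ρ s)` is smooth on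
all of `ℝ²` once `S + ρ/2 < D/2`, agrees with `compCoord` on the unsaturated strip (where it solves
the equation), and its partial derivatives `compSatX`, `compSatS` (components of `fderiv`) are the
smooth data `Fₓ, Fₛ` fed to `PlanarInterpShearBand.lean`.

Folklore; no named facts. Infrastructure towards a discharge of `acm_compatible_blocks`
(`QuasiSelfSimilarCompatibleBlocks.lean`).
-/

noncomputable section

open Function Set Filter Topology
open scoped ContDiff

namespace Literature.Analysis.FluidPDE

namespace PlanarKinematics

open Literature.Analysis.FluidPDE.Gluing

/-! ## The saturation of the offset -/

/-- **Saturated offset**: `σ(s) = jogProfile (-S) S ρ s - S + ρ/2`; the identity on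
`[-S + 2ρ/3, S + ρ/3]`, constant `∓(S - ρ/2)`… precisely `-S + ρ/2` before `-S + ρ/3` and
`S + ρ/2` after `S + 2ρ/3`. [folklore] -/
def satOffset (S ρ s : ℝ) : ℝ := jogProfile (-S) S ρ s - S + ρ / 2

/-- Unfolding. [folklore] -/
theorem satOffset_apply (S ρ s : ℝ) : satOffset S ρ s = jogProfile (-S) S ρ s - S + ρ / 2 := rfl

/-- **The saturation is the identity on the unsaturated strip.** [folklore] -/
theorem satOffset_of_mem {S ρ s : ℝ} (hρ : 0 < ρ) (h1 : -S + 2 * ρ / 3 ≤ s) (h2 : s ≤ S + ρ / 3) :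
    satOffset S ρ s = s := by
  rw [satOffset_apply, jogProfile_of_mem hρ (by linarith) h2]; ring

/-- The saturation is smooth. [folklore] -/
theorem satOffset_contDiff (S ρ : ℝ) {n : ℕ∞} : ContDiff ℝ n (satOffset S ρ) :=
  (jogProfile_contDiff.sub contDiff_const).add contDiff_const

/-- The saturation is monotone (`ρ > 0`, `S ≥ 0`). [folklore] -/
theorem satOffset_monotone {S ρ : ℝ} (hρ : 0 < ρ) (hS : 0 ≤ S) : Monotone (satOffset S ρ) := by
  have hd : Differentiable ℝ (satOffset S ρ) := (satOffset_contDiff S ρ (n := 1)).differentiable one_ne_zero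
  refine monotone_of_deriv_nonneg hd fun s => ?_
  have h : deriv (satOffset S ρ) s = deriv (jogProfile (-S) S ρ) s := by
    rw [show satOffset S ρ = fun s => jogProfile (-S) S ρ s - S + ρ / 2 from rfl]
    rw [deriv_add_const, deriv_sub_const]
  rw [h]
  exact (deriv_jogProfile_mem_Icc hρ (by linarith) s).1

/-- **The saturation takes values in `[-S + ρ/2, S + ρ/2]`** (`ρ > 0`, `S ≥ 0`). [folklore] -/
theorem satOffset_mem_Icc {S ρ : ℝ} (hρ : 0 < ρ) (hS : 0 ≤ S) (s : ℝ) :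
    satOffset S ρ s ∈ Icc (-S + ρ / 2) (S + ρ / 2) := by
  have hmono := satOffset_monotone hρ hS
  have hlo : satOffset S ρ (-S + ρ / 3) = -S + ρ / 2 := by
    rw [satOffset_apply, jogProfile_of_le hρ (by linarith) (by linarith)]; ring
  have hhi : satOffset S ρ (S + 2 * ρ / 3) = S + ρ / 2 := by
    rw [satOffset_apply, jogProfile_of_ge hρ (by linarith) (by linarith)]; ring
  constructor
  · rcases le_or_gt (-S + ρ / 3) s with h | h
    · rw [← hlo]; exact hmono h
    · rw [satOffset_apply, jogProfile_of_le hρ (by linarith) h.le]; linarith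
  · rcases le_or_gt s (S + 2 * ρ / 3) with h | h
    · rw [← hhi]; exact hmono h
    · rw [satOffset_apply, jogProfile_of_ge hρ (by linarith) h.le]; linarith

/-- The saturation stays in the band `|σ| < D/2` when `S + ρ/2 < D/2`. [folklore] -/
theorem abs_satOffset_lt {S ρ D : ℝ} (hρ : 0 < ρ) (hS : 0 ≤ S) (h : S + ρ / 2 < D / 2) (s : ℝ) :
    |satOffset S ρ s| < D / 2 := by
  obtain ⟨h1, h2⟩ := satOffset_mem_Icc hρ hS s
  rw [abs_lt]; constructor <;> linarith

/-! ## The saturated coordinate -/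

/-- **Saturated compensated coordinate** `F̃(x, s) = F(x, σ(s))`. [folklore] -/
def compCoordSat (D S ρ x s : ℝ) : ℝ := compCoord D x (satOffset S ρ s)

/-- Unfolding. [folklore] -/
theorem compCoordSat_apply (D S ρ x s : ℝ) : compCoordSat D S ρ x s = compCoord D x (satOffset S ρ s) := rfl

/-- **On the unsaturated strip the saturated coordinate is the coordinate.** [folklore] -/
theorem compCoordSat_of_mem {D S ρ x s : ℝ} (hρ : 0 < ρ) (h1 : -S + 2 * ρ / 3 ≤ s) (h2 : s ≤ S + ρ / 3) :
    compCoordSat D S ρ x s = compCoord D x s := by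
  rw [compCoordSat_apply, satOffset_of_mem hρ h1 h2]

/-- The saturated coordinate vanishes on the graph (`0` lies in the unsaturated strip when
`2ρ/3 ≤ S`). [folklore] -/
theorem compCoordSat_zero_right {D S ρ : ℝ} (hρ : 0 < ρ) (hS : 2 * ρ / 3 ≤ S) (x : ℝ) : compCoordSat D S ρ x 0 = 0 := by
  rw [compCoordSat_of_mem hρ (by linarith) (by linarith), compCoord_zero_right]

/-- **The saturated coordinate is smooth on all of `ℝ²`** when `S + ρ/2 < D/2`. [folklore] -/
theorem compCoordSat_contDiff {D S ρ : ℝ} (hD : 0 < D) (hρ : 0 < ρ) (hS : 0 ≤ S) (h : S + ρ / 2 < D / 2) {n : ℕ∞} :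
    ContDiff ℝ n (fun q : ℝ × ℝ => compCoordSat D S ρ q.1 q.2) := by
  have hin : ContDiff ℝ n fun q : ℝ × ℝ => ((q.1, satOffset S ρ q.2) : ℝ × ℝ) :=
    contDiff_fst.prodMk ((satOffset_contDiff S ρ).comp contDiff_snd)
  rw [contDiff_iff_contDiffAt]
  intro q
  have hmem : (q.1, satOffset S ρ q.2) ∈ compDom D := abs_satOffset_lt hρ hS h q.2
  exact (compCoord_contDiffAt hD hmem).comp q hin.contDiffAt

/-- The unsaturated open strip. [folklore] -/
def satStrip (S ρ : ℝ) : Set (ℝ × ℝ) := {q | -S + 2 * ρ / 3 < q.2 ∧ q.2 < S + ρ / 3}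

/-- The strip is open. [folklore] -/
theorem isOpen_satStrip (S ρ : ℝ) : IsOpen (satStrip S ρ) :=
  (isOpen_lt continuous_const continuous_snd).inter (isOpen_lt continuous_snd continuous_const)

/-- On the strip the saturated coordinate is eventually the coordinate. [folklore] -/
theorem compCoordSat_eventuallyEq {D S ρ : ℝ} (hρ : 0 < ρ) {p : ℝ × ℝ} (hp : p ∈ satStrip S ρ) :
    (fun q : ℝ × ℝ => compCoordSat D S ρ q.1 q.2) =ᶠ[𝓝 p] fun q : ℝ × ℝ => compCoord D q.1 q.2 := by
  filter_upwards [(isOpen_satStrip S ρ).mem_nhds hp] with q hq using compCoordSat_of_mem hρ hq.1.le hq.2.le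

/-- **The saturated coordinate solves `(1 + λ' s) Fₛ - λ Fₓ = 1` on the unsaturated strip**
(`S + ρ/3 ≤ D/2`, so that the strip lies in the band). [folklore] -/
theorem compCoordSat_pde {D S ρ : ℝ} (hD : 0 < D) (hρ : 0 < ρ) (h : S + ρ / 3 ≤ D / 2) {p : ℝ × ℝ}
    (hp : p ∈ satStrip S ρ) :
    (1 + deriv (shearProfile D) p.1 * p.2) * fderiv ℝ (fun q : ℝ × ℝ => compCoordSat D S ρ q.1 q.2) p (0, 1) -
      shearProfile D p.1 * fderiv ℝ (fun q : ℝ × ℝ => compCoordSat D S ρ q.1 q.2) p (1, 0) = 1 := by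
  rw [(compCoordSat_eventuallyEq hρ hp).fderiv_eq]
  refine compCoord_pde hD ?_
  show |p.2| < D / 2
  obtain ⟨h1, h2⟩ := hp
  rw [abs_lt]; constructor <;> linarith

/-! ## The partial derivatives as data -/

/-- `Fₓ`: the first partial derivative of the saturated coordinate. [folklore] -/
def compSatX (D S ρ x s : ℝ) : ℝ := fderiv ℝ (fun q : ℝ × ℝ => compCoordSat D S ρ q.1 q.2) (x, s) (1, 0)

/-- `Fₛ`: the second partial derivative of the saturated coordinate. [folklore] -/
def compSatS (D S ρ x s : ℝ) : ℝ := fderiv ℝ (fun q : ℝ × ℝ => compCoordSat D S ρ q.1 q.2) (x, s) (0, 1)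

/-- A continuous linear functional on `ℝ²` is determined by its values on the basis. [folklore] -/
theorem clm_eq_smul_fst_add_smul_snd (L : ℝ × ℝ →L[ℝ] ℝ) :
    L = L (1, 0) • ContinuousLinearMap.fst ℝ ℝ ℝ + L (0, 1) • ContinuousLinearMap.snd ℝ ℝ ℝ := by
  refine ContinuousLinearMap.ext fun q => ?_
  have e : q = q.1 • ((1 : ℝ), (0 : ℝ)) + q.2 • ((0 : ℝ), (1 : ℝ)) := by ext <;> simp
  conv_lhs => rw [e]
  simp only [map_add, map_smul, smul_eq_mul, _root_.add_apply, _root_.smul_apply, ContinuousLinearMap.coe_fst',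
    ContinuousLinearMap.coe_snd']
  ring

/-- **The derivative of the saturated coordinate in terms of its partials**: everywhere,
`D F̃(x, s) = Fₓ • fst + Fₛ • snd`. [folklore] -/
theorem hasFDerivAt_compCoordSat {D S ρ : ℝ} (hD : 0 < D) (hρ : 0 < ρ) (hS : 0 ≤ S) (h : S + ρ / 2 < D / 2) (x s : ℝ) :
    HasFDerivAt (uncurry (compCoordSat D S ρ))
      (compSatX D S ρ x s • ContinuousLinearMap.fst ℝ ℝ ℝ + compSatS D S ρ x s • ContinuousLinearMap.snd ℝ ℝ ℝ) (x, s) := by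
  have hd : DifferentiableAt ℝ (fun q : ℝ × ℝ => compCoordSat D S ρ q.1 q.2) (x, s) :=
    ((compCoordSat_contDiff hD hρ hS h (n := 1)).differentiable one_ne_zero) (x, s)
  have e : uncurry (compCoordSat D S ρ) = fun q : ℝ × ℝ => compCoordSat D S ρ q.1 q.2 := by
    funext q; rfl
  rw [e, compSatX, compSatS]
  have hF := hd.hasFDerivAt
  rwa [clm_eq_smul_fst_add_smul_snd (fderiv ℝ (fun q : ℝ × ℝ => compCoordSat D S ρ q.1 q.2) (x, s))] at hF

/-- **The first-order equation in terms of the partial data** on the unsaturated strip. [folklore] -/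
theorem compSat_pde {D S ρ : ℝ} (hD : 0 < D) (hρ : 0 < ρ) (h : S + ρ / 3 ≤ D / 2) {x s : ℝ}
    (hs : (x, s) ∈ satStrip S ρ) :
    (1 + deriv (shearProfile D) x * s) * compSatS D S ρ x s - shearProfile D x * compSatX D S ρ x s = 1 :=
  compCoordSat_pde hD hρ h hs

/-- `Fₓ` is smooth. [folklore] -/
theorem compSatX_contDiff {D S ρ : ℝ} (hD : 0 < D) (hρ : 0 < ρ) (hS : 0 ≤ S) (h : S + ρ / 2 < D / 2) {n : ℕ∞} :
    ContDiff ℝ n (uncurry (compSatX D S ρ)) := by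
  have hF : ContDiff ℝ (n + 1) (fun q : ℝ × ℝ => compCoordSat D S ρ q.1 q.2) :=
    compCoordSat_contDiff hD hρ hS h (n := n + 1)
  have hf : ContDiff ℝ n (fderiv ℝ (fun q : ℝ × ℝ => compCoordSat D S ρ q.1 q.2)) :=
    hF.fderiv_right (by norm_cast)
  have e : uncurry (compSatX D S ρ) = fun q : ℝ × ℝ => fderiv ℝ (fun q : ℝ × ℝ => compCoordSat D S ρ q.1 q.2) q (1, 0) := by
    funext q; rfl
  rw [e]
  exact hf.clm_apply contDiff_const

/-- `Fₛ` is smooth. [folklore] -/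
theorem compSatS_contDiff {D S ρ : ℝ} (hD : 0 < D) (hρ : 0 < ρ) (hS : 0 ≤ S) (h : S + ρ / 2 < D / 2) {n : ℕ∞} :
    ContDiff ℝ n (uncurry (compSatS D S ρ)) := by
  have hF : ContDiff ℝ (n + 1) (fun q : ℝ × ℝ => compCoordSat D S ρ q.1 q.2) :=
    compCoordSat_contDiff hD hρ hS h (n := n + 1)
  have hf : ContDiff ℝ n (fderiv ℝ (fun q : ℝ × ℝ => compCoordSat D S ρ q.1 q.2)) :=
    hF.fderiv_right (by norm_cast)
  have e : uncurry (compSatS D S ρ) = fun q : ℝ × ℝ => fderiv ℝ (fun q : ℝ × ℝ => compCoordSat D S ρ q.1 q.2) q (0, 1) := by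
    funext q; rfl
  rw [e]
  exact hf.clm_apply contDiff_const

/-- The saturated coordinate is smooth as an uncurried function (the form used by
`PlanarInterpShearBand`). [folklore] -/
theorem compCoordSat_contDiff_uncurry {D S ρ : ℝ} (hD : 0 < D) (hρ : 0 < ρ) (hS : 0 ≤ S) (h : S + ρ / 2 < D / 2)
    {n : ℕ∞} : ContDiff ℝ n (uncurry (compCoordSat D S ρ)) :=
  compCoordSat_contDiff hD hρ hS h

end PlanarKinematics

end Literature.Analysis.FluidPDE
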